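/-
Copyright (c) 2026. All rights reserved.
Released under Apache 2.0 license as described in the file LICENSE.
Authors: HodgeCM publication cell (pub-hodgecm), GR lane, third hand (`pub-hodgecm-own-crow`).
-/
import Literature.NumberTheory.Weil1964.AdelicMetaplecticUnitaryLeg
import Literature.NumberTheory.Weil1964.AdelicMetaplecticL2Scalar
import HarnessLib

/-!
# The operators of `Mp_ψ(W_𝐀)ᶜᵒⁿᵗ` are scaled isometries for every `L²(ν)`-normed embedding of `𝒮(𝐀_Fⁿ)`

Topic `NumberTheory/Weil1964`; namespace `Literature.NumberTheory.Weil1964`.  KERNEL ONLY: theorems, no definition,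
nothing of [Weil1964] or [GelbartRogawski1991] asserted.

`AdelicMetaplecticUnitaryLeg` (GR-2) builds the UNITARY leg `ψ : Mp_ψ(W_𝐀)ᶜᵒⁿᵗ →* MpPsi ρ_H` of the group of record on an
abstract completion `i : 𝒮(𝐀_F^ι) →ₗ[ℂ] H` GIVEN `hall : ∀ p, toOp p ∈ scaledIsometries i` — and reduces `hall` to the
three generator families (`adelicMpCont.toOp_mem_scaledIsometries_of_generators'`: Levi operators scaled, chirps and the
Fourier operator of one self-dual measure exactly isometric).  `AdelicMetaplecticL2Scalar` §1 (with the adelic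
PLANCHEREL formula `AdelicPiSchwartzBruhatPlancherel`) proves exactly these three facts for the `L²(ν)` functional
`Φ ↦ ∫⁻ ‖Φ‖ₑ² dν` of ANY additive Haar measure `ν` on `𝐀_Fⁿ`.  This file puts the two together:

* **`adelicMpCont.toOp_mem_scaledIsometries_of_norm_sq_eq_lintegral`**: if `‖i Φ‖² = ∫ ‖Φ‖² dν` for all
  `Φ ∈ 𝒮(𝐀_Fⁿ)` (an `L²(ν)`-NORMED embedding: e.g. `Φ ↦ [Φ] ∈ L²(𝐀_Fⁿ, ν)`), then EVERY operator of `Mp_ψ(W_𝐀)ᶜᵒⁿᵗ`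
  (`T` invertible) is a scaled `i`-isometry — the hypothesis `hall` of `adelicMpCont.unitaryLeg` for the `L²` models;
* the generator facts in the normed form GR-2's reduction consumes: `norm_toOp_leviPair_eq` (`‖i(Φ ∘ a⁻¹)‖ =
  |det a|_𝐀^{1/2} ‖i Φ‖`), `norm_toOp_unipPair_eq`, `norm_fourierEquiv_symm_eq` (Plancherel: `‖i Φ̂(-·)‖ = ‖i Φ‖` for the
  self-dual transform, in every `L²(ν)` norm).

So for the `L²(𝐀_Fⁿ)` model of `ρ_ψ` the only inputs of `unitaryLeg` still external to this lane are the dense range of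
`i` and the `L²` extension of `ρ_ψ` (GR-1's `AdelicSchrodingerL2Dense`).  Nothing is cited as a hypothesis.

## References
* [Weil1964] A. Weil, Acta Math. 111 (1964) 143–211, Chap. I n° 11, n° 13 p. 160.
* [GelbartRogawski1991] S. Gelbart, J. Rogawski, Invent. Math. 105 (1991), §3.1 p. 454 L21–27.
* [CasselsFrohlichANT1967] J. Tate, in Cassels–Fröhlich (eds.), *Algebraic Number Theory* (1967), Ch. XV, Thm. 4.1.2.
* [WeilBNT1967] A. Weil, *Basic Number Theory* (1967), Ch. IV §3, Cor. 1 of Prop. 3.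
-/

set_option autoImplicit false

noncomputable section

open scoped Matrix ENNReal NNReal
open NumberField MeasureTheory MeasureTheory.Measure

namespace Literature.NumberTheory.Weil1964

open Literature.NumberTheory.Automorphic Literature.RepresentationTheory.HeisenbergGroup
  Literature.RepresentationTheory.Unitary

variable (F : Type) [Field F] [NumberField F] {n : ℕ}
variable (T : Matrix (Fin n) (Fin n) (AdeleRing (𝓞 F) F)) (hT : IsUnit T.det)
variable [MeasurableSpace (AdeleRing (𝓞 F) F)] [BorelSpace (AdeleRing (𝓞 F) F)]
  (ν : Measure (Fin n → AdeleRing (𝓞 F) F)) [ν.IsAddHaarMeasure]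
variable {H : Type*} [NormedAddCommGroup H] [NormedSpace ℂ H] (i : piSchwartzBruhat F (Fin n) →ₗ[ℂ] H)
  (hi : ∀ Φ : piSchwartzBruhat F (Fin n),
    ‖i Φ‖ ^ 2 = (∫⁻ x, ‖(Φ : (Fin n → AdeleRing (𝓞 F) F) → ℂ) x‖ₑ ^ 2 ∂ν).toReal)

/-! ## §1 The generator families in an `L²(ν)`-normed embedding -/

omit [BorelSpace (AdeleRing (𝓞 F) F)] [ν.IsAddHaarMeasure] in
/-- from squares to norms: `‖i Ψ‖² = r² ‖i Φ‖²`-type identities of `L²` integrals give `‖i Ψ‖ = r ‖i Φ‖`.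
[folklore] -/
private theorem norm_eq_mul_norm_of_lintegral_eq {Ψ Φ : piSchwartzBruhat F (Fin n)} {c : ℝ≥0∞}
    (hi : ∀ Φ : piSchwartzBruhat F (Fin n),
      ‖i Φ‖ ^ 2 = (∫⁻ x, ‖(Φ : (Fin n → AdeleRing (𝓞 F) F) → ℂ) x‖ₑ ^ 2 ∂ν).toReal)
    (h : ∫⁻ x, ‖(Ψ : (Fin n → AdeleRing (𝓞 F) F) → ℂ) x‖ₑ ^ 2 ∂ν =
      c * ∫⁻ x, ‖(Φ : (Fin n → AdeleRing (𝓞 F) F) → ℂ) x‖ₑ ^ 2 ∂ν) :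
    ‖i Ψ‖ = Real.sqrt c.toReal * ‖i Φ‖ := by
  have hsq : ‖i Ψ‖ ^ 2 = (Real.sqrt c.toReal * ‖i Φ‖) ^ 2 := by
    rw [mul_pow, Real.sq_sqrt ENNReal.toReal_nonneg, hi Ψ, hi Φ, h, ENNReal.toReal_mul]
  exact (pow_left_inj₀ (norm_nonneg _) (mul_nonneg (Real.sqrt_nonneg _) (norm_nonneg _)) two_ne_zero).1 hsq

include hi in
/-- **Levi operators**: `‖i (Φ ∘ a⁻¹)‖ = |det ((a⁻¹)ᵀ)⁻¹|_𝐀^{1/2} · ‖i Φ‖ = |det a|_𝐀^{1/2} ‖i Φ‖` in every `L²(ν)` norm.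
[cite: WeilBNT1967, Ch. IV §3 Cor. 1] [cite: Weil1964, Chap. I n° 13 p. 160] -/
theorem norm_toOp_leviPair_eq (a : GL (Fin n) (AdeleRing (𝓞 F) F)) (Φ : piSchwartzBruhat F (Fin n)) :
    ‖i (MpPsi.toOp (adelicSchrodinger F (Fin n) T) (leviPair F T hT a) Φ)‖ =
      Real.sqrt ((adelicAbsDet n F (trInv a)⁻¹ : ℝ≥0) : ℝ) * ‖i Φ‖ := by
  have h : ∫⁻ x, ‖((MpPsi.toOp (adelicSchrodinger F (Fin n) T) (leviPair F T hT a) Φ : piSchwartzBruhat F (Fin n)) :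
        (Fin n → AdeleRing (𝓞 F) F) → ℂ) x‖ₑ ^ 2 ∂ν =
      ((adelicAbsDet n F (trInv a)⁻¹ : ℝ≥0) : ℝ≥0∞) * ∫⁻ x, ‖(Φ : (Fin n → AdeleRing (𝓞 F) F) → ℂ) x‖ₑ ^ 2 ∂ν :=
    (coe_toOp_leviPair F T hT a Φ) ▸ lintegral_enorm_sq_twist F ν (trInv a) Φ
  have := norm_eq_mul_norm_of_lintegral_eq F ν i hi h
  rwa [ENNReal.coe_toReal] at this

omit [BorelSpace (AdeleRing (𝓞 F) F)] [ν.IsAddHaarMeasure] in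
include hi in
/-- **chirps**: `‖i (ψ(-½ ᵗu c u) Φ)‖ = ‖i Φ‖` in every `L²(ν)` norm (unimodular multiplier).
[cite: Weil1964, Chap. I n° 13 p. 160] -/
theorem norm_toOp_unipPair_eq (c : Matrix (Fin n) (Fin n) (AdeleRing (𝓞 F) F)) (hc : c.IsSymm)
    (Φ : piSchwartzBruhat F (Fin n)) :
    ‖i (MpPsi.toOp (adelicSchrodinger F (Fin n) T) (unipPair F T hT c hc) Φ)‖ = ‖i Φ‖ := by
  have h : ∫⁻ x, ‖((MpPsi.toOp (adelicSchrodinger F (Fin n) T) (unipPair F T hT c hc) Φ : piSchwartzBruhat F (Fin n)) :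
        (Fin n → AdeleRing (𝓞 F) F) → ℂ) x‖ₑ ^ 2 ∂ν =
      1 * ∫⁻ x, ‖(Φ : (Fin n → AdeleRing (𝓞 F) F) → ℂ) x‖ₑ ^ 2 ∂ν :=
    (coe_toOp_unipPair F T hT c hc Φ) ▸ (lintegral_enorm_sq_chirp F ν _ Φ).trans (one_mul _).symm
  have := norm_eq_mul_norm_of_lintegral_eq F ν i hi h
  rwa [ENNReal.toReal_one, Real.sqrt_one, one_mul] at this

include hi in
/-- **the Fourier operator** `(fourierEquiv ν₀)⁻¹ : Φ ↦ Φ̂(-·)` of a self-dual Haar measure `ν₀` is an EXACT isometry in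
every `L²(ν)` norm — Plancherel (`AdelicPiSchwartzBruhatPlancherel`, `lintegral_enorm_sq_adelicPiFourier_neg`).
[cite: CasselsFrohlichANT1967, Ch. XV (Tate), Thm. 4.1.2] [cite: Weil1964, Chap. I n° 13 p. 160] -/
theorem norm_fourierEquiv_symm_eq (ν₀ : Measure (Fin n → AdeleRing (𝓞 F) F)) [ν₀.IsAddHaarMeasure]
    (hν₀ : ν₀ (piFundamentalDomain F (Fin n)) = 1) (Φ : piSchwartzBruhat F (Fin n)) :
    ‖i ((fourierEquiv F (Fin n) ν₀ hν₀).symm Φ)‖ = ‖i Φ‖ := by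
  have h : ∫⁻ x, ‖(((fourierEquiv F (Fin n) ν₀ hν₀).symm Φ : piSchwartzBruhat F (Fin n)) :
        (Fin n → AdeleRing (𝓞 F) F) → ℂ) x‖ₑ ^ 2 ∂ν =
      1 * ∫⁻ x, ‖(Φ : (Fin n → AdeleRing (𝓞 F) F) → ℂ) x‖ₑ ^ 2 ∂ν :=
    (coe_fourierEquiv_symm hν₀ Φ) ▸
      (lintegral_enorm_sq_adelicPiFourier_neg F ν ν₀ hν₀ Φ.2).trans (one_mul _).symm
  have := norm_eq_mul_norm_of_lintegral_eq F ν i hi h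
  rwa [ENNReal.toReal_one, Real.sqrt_one, one_mul] at this

/-! ## §2 `hall` for `L²(ν)`-normed embeddings -/

include hT hi in
/-- **EVERY OPERATOR OF `Mp_ψ(W_𝐀)ᶜᵒⁿᵗ` IS A SCALED ISOMETRY FOR AN `L²(ν)`-NORMED EMBEDDING** `i : 𝒮(𝐀_Fⁿ) →ₗ[ℂ] H`
(`‖i Φ‖² = ∫ ‖Φ‖² dν`, `ν` any additive Haar measure, `T` invertible): the hypothesis `hall` of
`adelicMpCont.unitaryLeg` for the `L²(𝐀_Fⁿ)` models of `ρ_ψ`.  Proof: GR-2's reduction to generators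
(`toOp_mem_scaledIsometries_of_generators'`) at a self-dual measure `ν₀`, fed with §1.
[cite: Weil1964, Chap. I n° 13 p. 160] [cite: GelbartRogawski1991, §3.1 p. 454 L21–27] -/
theorem adelicMpCont.toOp_mem_scaledIsometries_of_norm_sq_eq_lintegral (p : adelicMpCont F (Fin n) T) :
    adelicMpCont.toOp F (Fin n) T p ∈ scaledIsometries i := by
  obtain ⟨ν₀, hν₀H, hν₀⟩ := exists_haar_measure_piFundamentalDomain_eq_one F (n := n)
  haveI := hν₀H
  refine adelicMpCont.toOp_mem_scaledIsometries_of_generators' T hT ν₀ hν₀ i (fun a => ?_)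
    (fun c hc Φ => norm_toOp_unipPair_eq F T hT ν i hi c hc Φ)
    (fun Φ => norm_fourierEquiv_symm_eq F ν i hi ν₀ hν₀ Φ) p
  refine ⟨Real.sqrt ((adelicAbsDet n F (trInv a)⁻¹ : ℝ≥0) : ℝ), Real.sqrt_pos.2 ?_,
    fun Φ => norm_toOp_leviPair_eq F T hT ν i hi a Φ⟩
  have h : adelicAbsDet n F (trInv a)⁻¹ ≠ 0 := by
    rw [adelicAbsDet_apply]; exact ideleNorm_ne_zero _
  exact_mod_cast pos_iff_ne_zero.2 h

include hT hi in
/-- the scale of `toOp p` in an `L²(ν)`-normed embedding is the square root of the constant of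
`adelicMpCont.exists_lintegral_enorm_sq_omega_eq_mul`: `‖i (ω(p)Φ)‖ = scale · ‖i Φ‖` with `scale² · ∫ ‖Φ‖² = ∫ ‖ω(p)Φ‖²`.
[cite: Weil1964, Chap. I n° 13 p. 160] -/
theorem adelicMpCont.norm_toOp_eq_scale_mul (p : adelicMpCont F (Fin n) T) (Φ : piSchwartzBruhat F (Fin n)) :
    ‖i (adelicMpCont.toOp F (Fin n) T p Φ)‖ = scale i (adelicMpCont.toOp F (Fin n) T p) * ‖i Φ‖ :=
  norm_apply_eq_scale_mul i (adelicMpCont.toOp_mem_scaledIsometries_of_norm_sq_eq_lintegral F T hT ν i hi p) Φ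

end Literature.NumberTheory.Weil1964

end
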